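import Summits.QuantumAdvantage.QuantumAdvantage.Theorems.CouplingDialPadded

/-!
# InversionDial (part H, object + plant) — unipotent inversion `UInvSlice k` / `B_k = InvHard k`, the transpose triple, `B_k ⟹ N_k`

Tree twin of node «InversionDial» (decomp-qadv · lens-3 · g13) §1–§2 (cut verbatim; only the namespace `Theses.InversionDial` →
`Theorems.InversionDial`).  The object: `UInst` (Boolean matrix `L`, source column `a`, target row `b`), its code `UInst.encode`
(`boolPair (matBits L) (e_a ++ e_b)`), `UInst.Sol U v` (some solution of `L s = e_a` has `s_b = v`), the promise problem `UInvSlice k`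
(`L` unipotent of index `≤ k(n)`; YES iff `(L⁻¹)_{ba} = 1`, NO iff `= 0`), `InvHard k` (`B_k`), `LogInvHard` (`B_{log₂ n+1}`, the crux),
`ConstInvHard`, `PolylogInvHard`, `invHard_mono`; semantics `sol_iff_minv` (`Sol ⟺ (minv L c)_{ba} = v`), `bd_uiter_trM`,
`unipotent_trM_of` / `unipotent_trM_iff` (transposition keeps the index).  The plant: the transpose triple `ptrip n Q α β`
(`blTable n 0 α Q β`, `blTable n 1 β Qᵀ α`, `Q ⊕ Qᵀ`) has coupled value EXACTLY `-(-1)^{⟨β, Q⁻¹α⟩}` for every invertible `Q`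
(`core_ptrip`, `csum_ptrip`, ★ `cvalue_ptrip`, `cvalue_ptrip_sgl`, `unipotent_ptrip`, `cvalue_ptrip_of_sol`); reading a `UInst` code
(`aRd`, `bRd`, `matRd_encodeU`, `aRd_encodeU`, `bRd_encodeU`, `arityU`), the string map `PsiP` (`PsiP_encode`, `isLit_ext`,
`isLit_blockDiag_trM`, `isLit_blTable_cube`, ★ `isProj_PsiP`, `pPoly`, `length_PsiP_le`), `PsiP_yes` / `PsiP_no`, and
★★ `nilRung_of_invHard : (∀ n, k n ≤ k' (n+n)) → InvHard k → NilRung k'`, `logNilRung_of_logInvHard`.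
No sorry · no instances / notation / native_decide · linter switch dupNamespace only.
-/

set_option linter.dupNamespace false

noncomputable section

namespace Summit.QuantumAdvantage.QuantumAdvantage.Theorems.InversionDial

open Finset
open Literature.Computability.Complexity
open Literature.Computability.QuantumComplexity
open Literature.Computability.MetaComplexity
open _root_.Computability (encodeNat)
open Summit.QuantumAdvantage.QuantumAdvantage.Theorems.HintDial
open Summit.QuantumAdvantage.QuantumAdvantage.Theorems.HintDial.Automaton
open Summit.QuantumAdvantage.QuantumAdvantage.Theorems.GapDial.Automaton (blockDiag blockDiag_left blockDiag_right
  mv_blockDiag bd_zero_left EE bxor_append sgl_castAdd)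
open Summit.QuantumAdvantage.QuantumAdvantage.Theorems.FlatDial (clen length_encode_eq_clen clen_injective clen_lt_clen le_clen
  tabN tabEquiv formOf pairOf tabOf pairOf_tabOf realisable signers rd pos pol ext rd_ext_encode pos_lt_clen tabN_le_clen tabN_eq
  acRealOver_parity acRealOver_and2 bit_parity signedSlice_not_mem_promiseLift_iff_no_signer length_encode_pairOf bd_bxor_left
  bd_zeroVec_left)
open Summit.QuantumAdvantage.QuantumAdvantage.Theorems.CouplingDial
open Summit.QuantumAdvantage.QuantumAdvantage.Theses.AnfPresentation (RungANonuniform RungA LiftA AnfEquiv NearExactIsExact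
  SignedExactSliceIsLift)
open CubicForm (bit)
open DerivativeWalsh (W)
open BuzetChailloux (bxor zeroVec)

/-! ## §1 The object: unipotent inversion instances, their codes, the promise problem `UInvSlice k` and `B_k = InvHard k` -/

/-- ★ AN INSTANCE OF UNIPOTENT INVERSION: a Boolean matrix `L` (row `i`, column `j` ↦ `L i j`), a source column `a`, a target row `b`. -/
structure UInst where
  /-- dimension -/
  n : ℕ
  /-- the matrix -/
  L : Fin n → Fin n → Bool
  /-- source column -/
  a : Fin n
  /-- target row -/
  b : Fin n

namespace UInst

/-- the code `⟨matrix bits ‖ e_a ++ e_b⟩` (matrix a doubled literal prefix exactly as for coupled triples, `boolPair`). -/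
def encode (U : UInst) : List Bool := boolPair (CTriple.matBits U.L) (List.ofFn (sgl U.a) ++ List.ofFn (sgl U.b))

/-- `U` IS SOLVED WITH VALUE `v`: some solution `s` of `L s = e_a` has `s_b = v` (for invertible `L`: `(L⁻¹)_{b a} = v`). -/
def Sol (U : UInst) (v : Bool) : Prop := ∃ s : Fin U.n → Bool, mv U.L s = sgl U.a ∧ s U.b = v

end UInst

/-- code length of dimension `n`. -/
def ulen (n : ℕ) : ℕ := 2 * (n * n) + 2 + (n + n)

/-- InversionDial helper `length_encodeU` (decomp-qadv lens-3 g13; see the module docstring). -/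
theorem length_encodeU (U : UInst) : U.encode.length = ulen U.n := by
  rw [UInst.encode, length_boolPair, length_matBits, List.length_append, List.length_ofFn, List.length_ofFn, ulen]

/-- InversionDial helper `le_ulen` (decomp-qadv lens-3 g13; see the module docstring). -/
theorem le_ulen (n : ℕ) : n ≤ ulen n := by unfold ulen; omega

/-- InversionDial helper `two_le_ulen` (decomp-qadv lens-3 g13; see the module docstring). -/
theorem two_le_ulen (n : ℕ) : 2 ≤ ulen n := by unfold ulen; omega

/-- InversionDial helper `ulen_le_ulen` (decomp-qadv lens-3 g13; see the module docstring). -/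
theorem ulen_le_ulen {n n' : ℕ} (h : n ≤ n') : ulen n ≤ ulen n' := by
  have h1 : n * n ≤ n' * n' := Nat.mul_le_mul h h
  unfold ulen; omega

/-- InversionDial helper `ulen_lt_ulen` (decomp-qadv lens-3 g13; see the module docstring). -/
theorem ulen_lt_ulen {n n' : ℕ} (h : n < n') : ulen n < ulen n' := by
  have h1 : n * n ≤ n' * n' := Nat.mul_le_mul h.le h.le
  unfold ulen; omega

/-- InversionDial helper `ulen_injective` (decomp-qadv lens-3 g13; see the module docstring). -/
theorem ulen_injective : Function.Injective ulen := by
  intro a b h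
  rcases lt_trichotomy a b with hab | hab | hab
  · exact absurd h (ulen_lt_ulen hab).ne
  · exact hab
  · exact absurd h (ulen_lt_ulen hab).ne'

/-- ★ THE INDEX-`k` UNIPOTENT INVERSION SLICE `𝓑_k`: codes of `(L, a, b)` with `L` unipotent of index `≤ k(n)`; YES iff `(L⁻¹)_{ba} = 1`,
NO iff `(L⁻¹)_{ba} = 0`.  Pure linear algebra over `𝔽₂`; no forms, no Forrelation. -/
def UInvSlice (k : ℕ → ℕ) : PromiseProblem :=
  ⟨UInst.encode '' {U | Unipotent U.L (k U.n) ∧ U.Sol true}, UInst.encode '' {U | Unipotent U.L (k U.n) ∧ U.Sol false}⟩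

/-- ★ `B_k`: unipotent inversion of index `≤ k(n)` is not in promise-`AC⁰[⊕]`. -/
def InvHard (k : ℕ → ℕ) : Prop := UInvSlice k ∉ promiseLift (AC0Mod 2)

/-- ★★ THE CRUX `B_log = B_{log₂ n + 1}`: is the `(b,a)` entry of the inverse of a unipotent `𝔽₂`-matrix of index `≤ log₂ n + 1`
(equivalently: the parity of the number of `a ⇝ b` paths of length `≤ log₂ n` in an acyclic-mod-identity pattern; an entry of an
iterated product of `log₂ n` Boolean matrices) outside promise-`AC⁰[⊕]`?  [crux · T-ORTHOGONAL · OPEN (Razborov–Smolensky blind at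
degree `log n`) · INSTRUMENTABLE via the depth split §6] -/
def LogInvHard : Prop := InvHard fun n => Nat.log 2 n + 1

/-- `B_{c+1}`, constant index — REFUTED for every `c` (`not_constInvHard`). -/
def ConstInvHard (c : ℕ) : Prop := InvHard fun _ => c + 1

/-- `B_{(log₂ n)^C + 1}`, polylogarithmic index (weaker as `C` grows; every one open). -/
def PolylogInvHard (C : ℕ) : Prop := InvHard fun n => Nat.log 2 n ^ C + 1

variable {k₁ k₂ : ℕ → ℕ}

/-- InversionDial helper `uInvSlice_yes_mono` (decomp-qadv lens-3 g13; see the module docstring). -/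
theorem uInvSlice_yes_mono (h : ∀ n, k₁ n ≤ k₂ n) {x : List Bool} (hx : x ∈ (UInvSlice k₁).yes) :
    x ∈ (UInvSlice k₂).yes := by
  obtain ⟨U, ⟨hu, hs⟩, rfl⟩ := hx; exact ⟨U, ⟨hu.mono (h _), hs⟩, rfl⟩

/-- InversionDial helper `uInvSlice_no_mono` (decomp-qadv lens-3 g13; see the module docstring). -/
theorem uInvSlice_no_mono (h : ∀ n, k₁ n ≤ k₂ n) {x : List Bool} (hx : x ∈ (UInvSlice k₁).no) :
    x ∈ (UInvSlice k₂).no := by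
  obtain ⟨U, ⟨hu, hs⟩, rfl⟩ := hx; exact ⟨U, ⟨hu.mono (h _), hs⟩, rfl⟩

/-- `B` is MONOTONE in the index: a larger promise is harder to separate. -/
theorem invHard_mono (h : ∀ n, k₁ n ≤ k₂ n) : InvHard k₁ → InvHard k₂ :=
  fun h₁ ⟨S, hS, hy, hn⟩ => h₁ ⟨S, hS, fun _ hx => hy (uInvSlice_yes_mono h hx), fun _ hx => hn (uInvSlice_no_mono h hx)⟩

/-- InversionDial helper `polylogInvHard_of_logInvHard` (decomp-qadv lens-3 g13; see the module docstring). -/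
theorem polylogInvHard_of_logInvHard {C : ℕ} (hC : 1 ≤ C) : LogInvHard → PolylogInvHard C :=
  invHard_mono fun n => Nat.succ_le_succ (Nat.le_self_pow (by omega) _)

/-! ### 1b Semantics: on a unipotent instance the value is the entry of `L⁻¹ = Σ_{j≤c} N^j`; transposes keep the index -/

variable {n : ℕ}

/-- ★ `Sol (L, a, b) v ⟺ (L⁻¹)_{b a} = v` for `L` unipotent of index `≤ c + 1` (`L⁻¹ = minv L c`, g12 `mv_mul_minv`/`mv_minv_mul`). -/
theorem sol_iff_minv {L : Fin n → Fin n → Bool} {c : ℕ} (hu : Unipotent L (c + 1)) (a b : Fin n) (v : Bool) :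
    UInst.Sol ⟨n, L, a, b⟩ v ↔ minv L c b a = v := by
  constructor
  · rintro ⟨s, hs, hb⟩
    have e : s = mv (minv L c) (sgl a) := by rw [← hs, mv_minv_mul hu]
    rw [← hb, e, mv_sgl_apply]
  · intro h
    exact ⟨mv (minv L c) (sgl a), mv_mul_minv hu _, by rw [mv_sgl_apply, h]⟩

/-- the value is determined (invertibility): no instance is both YES and NO. -/
theorem sol_unique {L : Fin n → Fin n → Bool} {j : ℕ} (hu : Unipotent L j) (a b : Fin n) {v w : Bool}
    (hv : UInst.Sol ⟨n, L, a, b⟩ v) (hw : UInst.Sol ⟨n, L, a, b⟩ w) : v = w := by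
  have hu' : Unipotent L (j + 1) := hu.mono (Nat.le_succ j)
  rw [← (sol_iff_minv hu' a b v).mp hv, ← (sol_iff_minv hu' a b w).mp hw]

/-- adjointness of the unipotent iteration: `⟨x, (Lᵀ ⊕ 𝟙)^j y⟩ = ⟨(L ⊕ 𝟙)^j x, y⟩`. -/
theorem bd_uiter_trM (L : Fin n → Fin n → Bool) (j : ℕ) (x y : Fin n → Bool) :
    bd x (uiter (trM L) j y) = bd (uiter L j x) y := by
  induction j generalizing x with
  | zero => rfl
  | succ j ih =>
    show bd x (bxor (mv (trM L) (uiter (trM L) j y)) (uiter (trM L) j y)) = bd (uiter L (j + 1) x) y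
    rw [bd_bxor_right, bd_mv_trM, ih, ih, ← bd_bxor_left, ← uiter_bxor, uiter_add L j 1 x]
    rfl

/-- ★ TRANSPOSITION KEEPS THE UNIPOTENCY INDEX. -/
theorem unipotent_trM_of {L : Fin n → Fin n → Bool} {j : ℕ} (h : Unipotent L j) : Unipotent (trM L) j := fun y => by
  funext i
  rw [← bd_sgl_left i (uiter (trM L) j y), bd_uiter_trM, h (sgl i), bd_zeroVec_left]
  rfl

/-- InversionDial helper `unipotent_trM_iff` (decomp-qadv lens-3 g13; see the module docstring). -/
theorem unipotent_trM_iff {L : Fin n → Fin n → Bool} {j : ℕ} : Unipotent (trM L) j ↔ Unipotent L j :=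
  ⟨fun h => unipotent_trM_of (L := trM L) h, unipotent_trM_of⟩

/-! ## §2 PLANT `B_k ⟹ N_k`: the transpose triple has coupled value EXACTLY `-(-1)^{(Q⁻¹)_{ba}}` for every invertible `Q` -/

/-- ★ THE TRANSPOSE TRIPLE of `(Q, α, β)`: `F = ⟨x′, Q x″ ⊕ α·?⟩`-table `blTable n 0 α Q β`, `G = blTable n 1 β Qᵀ α`, coupling `Q ⊕ Qᵀ`
(the g9/g12 hidden-coupling instance `hinst w` is the case `Q = Q_w`, `α = e_{a₀}`, `β = e_{b₀}`). -/
def ptrip (n : ℕ) (Q : Fin n → Fin n → Bool) (α β : Fin n → Bool) : CTriple :=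
  ⟨n + n, blTable n false α Q β, blTable n true β (trM Q) α, blockDiag Q (trM Q)⟩

section Plant

variable {Q M : Fin n → Fin n → Bool} {α β : Fin n → Bool}
/-- pointwise core of the coupled sum (after the `x`-sum = Walsh transform of `F`, g6 `W_blTable`). -/
theorem core_ptrip (h₁ : ∀ x, mv Q (mv M x) = x) (h₂ : ∀ x, mv M (mv Q x) = x) (y₁ y₂ : Fin n → Bool) :
    2 ^ n * (signOf false * twist β (mv M (bxor α (mv Q y₁))) * twist (mv M (bxor α (mv Q y₁))) (mv (trM Q) y₂)) *
        signOf ((blTable n true β (trM Q) α).eval (Fin.append y₁ y₂))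
      = -(2 : ℝ) ^ n * signOf (bd β (mv M α)) := by
  rw [mv_bxor, h₂, ← signOf_bd, ← signOf_bd, bd_mv_trM, mv_bxor, h₁, bd_bxor_left, bd_bxor_right, eval_blTable, bd_mv_trM]
  cases bd β (mv M α) <;> cases bd β y₁ <;> cases bd α y₂ <;> cases bd (mv Q y₁) y₂ <;> norm_num [signOf]
/-- ★ THE COUPLED SUM of the transpose triple: `-2^n · 2^{2n} · (-1)^{⟨β, Q⁻¹ α⟩}`. -/
theorem csum_ptrip (h₁ : ∀ x, mv Q (mv M x) = x) (h₂ : ∀ x, mv M (mv Q x) = x) :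
    ∑ x : Fin (n + n) → Bool, ∑ y : Fin (n + n) → Bool,
        signOf ((blTable n false α Q β).eval x) * twist x (mv (blockDiag Q (trM Q)) y) *
          signOf ((blTable n true β (trM Q) α).eval y)
      = -((2 : ℝ) ^ n * 2 ^ (n + n)) * signOf (bd β (mv M α)) := by
  rw [sum_comm]
  simp_rw [← sum_mul]
  rw [sum_append]
  simp_rw [mv_blockDiag]
  have hW : ∀ y₁ y₂ : Fin n → Bool,
      ∑ x : Fin (n + n) → Bool, signOf ((blTable n false α Q β).eval x) * twist x (Fin.append (mv Q y₁) (mv (trM Q) y₂))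
        = 2 ^ n * (signOf false * twist β (mv M (bxor α (mv Q y₁))) * twist (mv M (bxor α (mv Q y₁))) (mv (trM Q) y₂)) :=
    fun y₁ y₂ => W_blTable h₁ (mv Q y₁) (mv (trM Q) y₂)
  rw [show (∑ y₁ : Fin n → Bool, ∑ y₂ : Fin n → Bool,
      (∑ x : Fin (n + n) → Bool, signOf ((blTable n false α Q β).eval x) * twist x (Fin.append (mv Q y₁) (mv (trM Q) y₂))) *
        signOf ((blTable n true β (trM Q) α).eval (Fin.append y₁ y₂)))
      = ∑ y₁ : Fin n → Bool, ∑ y₂ : Fin n → Bool, -(2 : ℝ) ^ n * signOf (bd β (mv M α)) from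
    sum_congr rfl fun y₁ _ => sum_congr rfl fun y₂ _ => by rw [hW]; exact core_ptrip h₁ h₂ y₁ y₂]
  simp only [sum_const, card_univ, Fintype.card_fun, Fintype.card_bool, Fintype.card_fin, nsmul_eq_mul, Nat.cast_pow,
    Nat.cast_ofNat]
  ring
/-- ★★ EXACTNESS + LABEL for EVERY invertible coupling: `Φ(ptrip Q α β) = -(-1)^{⟨β, Q⁻¹ α⟩}` (modulus exactly `1`). -/
theorem cvalue_ptrip (h₁ : ∀ x, mv Q (mv M x) = x) (h₂ : ∀ x, mv M (mv Q x) = x) :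
    (ptrip n Q α β).cvalue = - signOf (bd β (mv M α)) := by
  show (Real.sqrt (2 ^ (3 * (n + n))))⁻¹ *
    ∑ x : Fin (n + n) → Bool, ∑ y : Fin (n + n) → Bool,
        signOf ((blTable n false α Q β).eval x) * twist x (mv (blockDiag Q (trM Q)) y) *
          signOf ((blTable n true β (trM Q) α).eval y) = _
  rw [csum_ptrip h₁ h₂]
  have h3 : Real.sqrt ((2 : ℝ) ^ (3 * (n + n))) = 2 ^ n * 2 ^ (n + n) := by
    rw [show 3 * (n + n) = 3 * n + 3 * n by ring, SgnForrMem.sqrt_two_pow_add_self, ← pow_add,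
      show n + (n + n) = 3 * n by ring]
  rw [h3]
  have h5 : (2 : ℝ) ^ n * 2 ^ (n + n) ≠ 0 := by positivity
  field_simp

end Plant
/-- ★★ `Φ(ptrip L e_a e_b) = -(-1)^{(L⁻¹)_{b a}}` for `L` unipotent of index `≤ j + 1`. -/
theorem cvalue_ptrip_sgl {L : Fin n → Fin n → Bool} {j : ℕ} (hu : Unipotent L (j + 1)) (a b : Fin n) :
    (ptrip n L (sgl a) (sgl b)).cvalue = - signOf (minv L j b a) := by
  rw [cvalue_ptrip (mv_mul_minv hu) (mv_minv_mul hu), bd_sgl_left, mv_sgl_apply]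
/-- the planted coupling `L ⊕ Lᵀ` keeps the index of `L`. -/
theorem unipotent_ptrip {L : Fin n → Fin n → Bool} {j : ℕ} (hu : Unipotent L j) (α β : Fin n → Bool) :
    Unipotent (ptrip n L α β).L j :=
  unipotent_blockDiag hu (unipotent_trM_of hu)
/-- ★ the planted value of a SOLVED instance: `Φ = -(-1)^v`, i.e. `+1` on YES, `-1` on NO. -/
theorem cvalue_ptrip_of_sol {k : ℕ → ℕ} (U : UInst) (hu : Unipotent U.L (k U.n)) {v : Bool} (hs : U.Sol v) :
    (ptrip U.n U.L (sgl U.a) (sgl U.b)).cvalue = - signOf v := by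
  have hu' : Unipotent U.L (k U.n + 1) := hu.mono (Nat.le_succ _)
  rw [cvalue_ptrip_sgl hu', (sol_iff_minv hu' U.a U.b v).mp hs]

/-! ### 2b Reading a `UInst` code and the string-level planting `Ψ` (a literal projection) -/
/-- reading `e_a` off a `UInst` code string. -/
def aRd (n N : ℕ) (y : Fin N → Bool) : Fin n → Bool := fun i => ext y (off n + i)
/-- reading `e_b` off a `UInst` code string. -/
def bRd (n N : ℕ) (y : Fin N → Bool) : Fin n → Bool := fun i => ext y (off n + n + i)
/-- InversionDial helper `matRd_encodeU` (decomp-qadv lens-3 g13; see the module docstring). -/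
theorem matRd_encodeU (U : UInst) : matRd U.n U.encode.length U.encode.get = U.L := by
  funext a b
  have hq : ((finProdFinEquiv (a, b) : Fin (U.n * U.n)) : ℕ) < U.n * U.n := Fin.isLt _
  show ext U.encode.get (2 * ((finProdFinEquiv (a, b) : Fin (U.n * U.n)) : ℕ)) = U.L a b
  rw [ext_get, UInst.encode, getD_boolPair_two_mul _ _ (by rw [length_matBits]; exact hq), CTriple.matBits,
    List.getD_eq_getElem?_getD]
  simp only [List.getElem?_ofFn, dif_pos hq, Option.getD_some, Fin.eta, Equiv.symm_apply_apply]
/-- InversionDial helper `aRd_encodeU` (decomp-qadv lens-3 g13; see the module docstring). -/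
theorem aRd_encodeU (U : UInst) : aRd U.n U.encode.length U.encode.get = sgl U.a := by
  funext i
  show ext U.encode.get (off U.n + i) = sgl U.a i
  rw [ext_get, UInst.encode, show off U.n + (i : ℕ) = 2 * (CTriple.matBits U.L).length + 2 + i by
    rw [length_matBits]; rfl, getD_boolPair_shift, List.getD_eq_getElem?_getD,
    List.getElem?_append_left (by simp), List.getElem?_ofFn]
  simp
/-- InversionDial helper `bRd_encodeU` (decomp-qadv lens-3 g13; see the module docstring). -/
theorem bRd_encodeU (U : UInst) : bRd U.n U.encode.length U.encode.get = sgl U.b := by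
  funext i
  show ext U.encode.get (off U.n + U.n + i) = sgl U.b i
  rw [ext_get, UInst.encode, show off U.n + U.n + (i : ℕ) = 2 * (CTriple.matBits U.L).length + 2 + (U.n + i) by
    rw [length_matBits]; unfold off; omega, getD_boolPair_shift, List.getD_eq_getElem?_getD,
    List.getElem?_append_right (by simp), List.getElem?_ofFn]
  simp

open Classical in
/-- the dimension read off a code length (junk `0`). -/
def arityU (N : ℕ) : ℕ := if h : ∃ n, ulen n = N then h.choose else 0
/-- InversionDial helper `arityU_ulen` (decomp-qadv lens-3 g13; see the module docstring). -/
theorem arityU_ulen (n : ℕ) : arityU (ulen n) = n := by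
  have h : ∃ n', ulen n' = ulen n := ⟨n, rfl⟩
  rw [arityU, dif_pos h]
  exact ulen_injective h.choose_spec
/-- InversionDial helper `arityU_le` (decomp-qadv lens-3 g13; see the module docstring). -/
theorem arityU_le (N : ℕ) : arityU N ≤ N := by
  unfold arityU
  split_ifs with h
  · have h1 := h.choose_spec
    have h2 := le_ulen h.choose
    omega
  · exact Nat.zero_le _
/-- ★ THE PLANTING MAP `Ψ`: read `(L, α, β)` off the string, output the code of the transpose triple. -/
def PsiP (N : ℕ) (u : Fin N → Bool) : List Bool :=
  (ptrip (arityU N) (matRd (arityU N) N u) (aRd (arityU N) N u) (bRd (arityU N) N u)).encode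
/-- InversionDial helper `PsiP_encode` (decomp-qadv lens-3 g13; see the module docstring). -/
theorem PsiP_encode (U : UInst) : PsiP U.encode.length U.encode.get = (ptrip U.n U.L (sgl U.a) (sgl U.b)).encode := by
  have hn : arityU U.encode.length = U.n := by rw [length_encodeU, arityU_ulen]
  unfold PsiP
  rw [hn, matRd_encodeU, aRd_encodeU, bRd_encodeU]
/-- InversionDial helper `isLit_ext` (decomp-qadv lens-3 g13; see the module docstring). -/
theorem isLit_ext {N : ℕ} (i : ℕ) : IsLit fun u : Fin N → Bool => ext u i := by
  by_cases h : i < N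
  · exact ⟨.inr (false, ⟨i, h⟩), fun u => by
      simp only [Summit.QuantumAdvantage.QuantumAdvantage.Theorems.FlatDial.ext, dif_pos h, evalLit, Bool.false_xor]⟩
  · exact ⟨.inl false, fun u => by
      simp only [Summit.QuantumAdvantage.QuantumAdvantage.Theorems.FlatDial.ext, dif_neg h, evalLit]⟩
/-- InversionDial helper `acRealOver_of_isLit` (decomp-qadv lens-3 g13; see the module docstring). -/
theorem acRealOver_of_isLit {N : ℕ} {g : (Fin N → Bool) → Bool} (h : IsLit g) : ACRealOver (accBasis 2) g 1 1 := by
  obtain ⟨ℓ, hℓ⟩ := h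
  exact (acRealOver_evalLit 2 ℓ).congr fun u => (hℓ u).symm
/-- InversionDial helper `isLit_matRd` (decomp-qadv lens-3 g13; see the module docstring). -/
theorem isLit_matRd {N : ℕ} (a b : Fin n) : IsLit fun u : Fin N → Bool => matRd n N u a b := isLit_ext _
/-- InversionDial helper `isLit_trM_matRd` (decomp-qadv lens-3 g13; see the module docstring). -/
theorem isLit_trM_matRd {N : ℕ} (a b : Fin n) : IsLit fun u : Fin N → Bool => trM (matRd n N u) a b := isLit_ext _
/-- InversionDial helper `isLit_blockDiag_trM` (decomp-qadv lens-3 g13; see the module docstring). -/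
theorem isLit_blockDiag_trM {N : ℕ} (a b : Fin (n + n)) :
    IsLit fun u : Fin N → Bool => blockDiag (matRd n N u) (trM (matRd n N u)) a b := by
  refine Fin.addCases (fun a₁ => ?_) (fun a₂ => ?_) a
  · simp_rw [blockDiag_left]
    refine Fin.addCases (fun b₁ => ?_) (fun b₂ => ?_) b
    · simp_rw [Fin.append_left]; exact isLit_matRd _ _
    · simp_rw [Fin.append_right]; exact IsLit.const _
  · simp_rw [blockDiag_right]
    refine Fin.addCases (fun b₁ => ?_) (fun b₂ => ?_) b
    · simp_rw [Fin.append_left]; exact IsLit.const _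
    · simp_rw [Fin.append_right]; exact isLit_trM_matRd _ _
/-- every cube coefficient of a two-sided table with literal data is a literal. -/
theorem isLit_blTable_cube {N : ℕ} (c : Bool) (α β : (Fin N → Bool) → Fin n → Bool) (Mx : (Fin N → Bool) → Fin n → Fin n → Bool)
    (hα : ∀ i, IsLit fun u => α u i) (hβ : ∀ i, IsLit fun u => β u i) (hM : ∀ i j, IsLit fun u => Mx u i j) (i j l : Fin (n + n)) :
    IsLit fun u : Fin N → Bool => (blTable n c (α u) (Mx u) (β u)).cube i j l := by
  unfold blTable
  refine IsLit.const_and _ ?_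
  generalize finSumFinEquiv.symm i = p
  generalize finSumFinEquiv.symm l = q
  rcases p with a | b <;> rcases q with a' | b'
  · exact IsLit.const_and _ (hα _)
  · exact hM _ _
  · exact IsLit.const _
  · exact IsLit.const_and _ (hβ _)
/-- ★ `Ψ` IS A LITERAL PROJECTION at every length. -/
theorem isProj_PsiP (N : ℕ) : IsProj (PsiP N) := by
  show IsProj fun u : Fin N → Bool =>
    boolPair (CTriple.matBits (blockDiag (matRd (arityU N) N u) (trM (matRd (arityU N) N u))))
      (boolPair (encodeNat (arityU N + arityU N))
        (boolPair (blTable (arityU N) false (aRd (arityU N) N u) (matRd (arityU N) N u) (bRd (arityU N) N u)).encode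
          (blTable (arityU N) true (bRd (arityU N) N u) (trM (matRd (arityU N) N u)) (aRd (arityU N) N u)).encode))
  exact (IsProj.ofFn _ fun q => IsProj.single (isLit_blockDiag_trM _ _)).boolPair ((IsProj.const _).boolPair
    ((isProj_encode_form (fun u => blTable (arityU N) false (aRd (arityU N) N u) (matRd (arityU N) N u) (bRd (arityU N) N u))
        false (fun _ => rfl) (isLit_blTable_cube false _ _ _ (fun i => isLit_ext _) (fun i => isLit_ext _)
          (fun i j => isLit_matRd i j))).boolPair
      (isProj_encode_form (fun u => blTable (arityU N) true (bRd (arityU N) N u) (trM (matRd (arityU N) N u)) (aRd (arityU N) N u))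
        true (fun _ => rfl) (isLit_blTable_cube true _ _ _ (fun i => isLit_ext _) (fun i => isLit_ext _)
          (fun i j => isLit_trM_matRd i j)))))
/-- length polynomial of `Ψ`. -/
def pPoly : Polynomial ℕ := tPoly.comp (2 * Polynomial.X)
/-- InversionDial helper `length_PsiP_le` (decomp-qadv lens-3 g13; see the module docstring). -/
theorem length_PsiP_le (N : ℕ) (u : Fin N → Bool) : (PsiP N u).length ≤ pPoly.eval N := by
  unfold PsiP
  rw [pPoly, Polynomial.eval_comp]
  refine (length_encode_le_tPoly _).trans (natPoly_eval_mono tPoly ?_)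
  show arityU N + arityU N ≤ _
  simp only [Polynomial.eval_mul, Polynomial.eval_ofNat, Polynomial.eval_X]
  have := arityU_le N
  omega
/-- InversionDial helper `one_le_pPoly` (decomp-qadv lens-3 g13; see the module docstring). -/
theorem one_le_pPoly (N : ℕ) : 1 ≤ pPoly.eval N := by
  simp only [pPoly, tPoly, Polynomial.eval_comp, Polynomial.eval_add, Polynomial.eval_mul, Polynomial.eval_pow,
    Polynomial.eval_X, Polynomial.eval_ofNat]
  omega

variable {k k' : ℕ → ℕ}
/-- InversionDial helper `PsiP_yes` (decomp-qadv lens-3 g13; see the module docstring). -/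
theorem PsiP_yes (hk : ∀ n, k n ≤ k' (n + n)) : ∀ x ∈ (UInvSlice k).yes, PsiP x.length x.get ∈ (NilSlice k').yes := by
  rintro x ⟨U, ⟨hu, hs⟩, rfl⟩
  rw [PsiP_encode]
  refine ⟨_, ⟨⟨U.n, rfl⟩, (unipotent_ptrip hu _ _).mono (hk U.n), ?_⟩, rfl⟩
  rw [cvalue_ptrip_of_sol U hu hs]
  norm_num [signOf]
/-- InversionDial helper `PsiP_no` (decomp-qadv lens-3 g13; see the module docstring). -/
theorem PsiP_no (hk : ∀ n, k n ≤ k' (n + n)) : ∀ x ∈ (UInvSlice k).no, PsiP x.length x.get ∈ (NilSlice k').no := by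
  rintro x ⟨U, ⟨hu, hs⟩, rfl⟩
  rw [PsiP_encode]
  refine ⟨_, ⟨⟨U.n, rfl⟩, (unipotent_ptrip hu _ _).mono (hk U.n), ?_⟩, rfl⟩
  rw [cvalue_ptrip_of_sol U hu hs]
  norm_num [signOf]
/-- ★★ PLANT: `B_k ⟹ N_{k'}` whenever `k(n) ≤ k'(2n)` (in particular `B_k ⟹ N_k` for monotone `k`).  [PROVED] -/
theorem nilRung_of_invHard (hk : ∀ n, k n ≤ k' (n + n)) : InvHard k → NilRung k' :=
  not_promiseLift_of_red PsiP (isACRed_of_isProj isProj_PsiP pPoly length_PsiP_le one_le_pPoly) (PsiP_yes hk) (PsiP_no hk)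
/-- InversionDial helper `logNilRung_of_logInvHard` (decomp-qadv lens-3 g13; see the module docstring). -/
theorem logNilRung_of_logInvHard : LogInvHard → LogNilRung :=
  nilRung_of_invHard fun n => Nat.succ_le_succ (Nat.log_mono_right (Nat.le_add_right n n))

end Summit.QuantumAdvantage.QuantumAdvantage.Theorems.InversionDial

end
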